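/-
Copyright: pub-balaban β-flow team, β-FLOW PROVER 4 (unit `b2b-balaban-beta-bflow-p4`, gen 7; coordinator ruling «YM
ACCELERATION» 2026-08-21 item (2), «work behind the as-printed interface»).  NON-VACUITY of PART 17b: one explicit `Setting`
(vacuum polarization := half an2's Maxwell kernel, quadratic part := the (3.67) double sum, ‖∂B‖² := the unit-weight curl form,
every field admissible, ζ := 1) meets `Definitions` and EVERY hypothesis of `zeta_eq_secondMoment_of_365_367`, whose conclusion
then reads 1 = secondMoment(½Π^ℤ) — an2's number 2, halved.  [folklore]; nothing of Bałaban's asserted; NOT BetaPertH, NOT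
continuum, NOT Clay.
-/
import Mathlib
import Summits.QuantumFields.BalabanUV.Beta.EriceZetaIdentificationWitness
import Summits.QuantumFields.BalabanUV.Beta.EriceZetaIdentificationEnd

/-!
# `Beta.EriceZetaIdentificationWitnessEnd` — PART 17d of the `EriceLoopExpansionD4` series: the hypotheses of PART 17b are
# jointly inhabited, non-trivially (Maxwell witness)

[folklore].  `hypotheses_inhabited`: a `BetaFlowAsPrinted.Setting` with `vacPol j s := ½·maxwellKernelZ 4` (≠ 0), `quad j s B := ½
Σ_{a,b} B(a)·½Π^ℤ_{a₂b₂}(a₁ − b₁)·B(b)` (so `Definitions.d367` is definitional), `halfCurlSq B := ¼ Σ_x Σ_{μ,ν} (B_μ(x) + B_ν(x+e_μ) −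
B_μ(x+e_ν) − B_ν(x))²` (so (N-curl) is definitional), `adm j := univ` ((N-adm) with c_j = 1), `ζ := 1`, `C365 := 0`, `α := 1`
satisfies `Definitions` — `d365` with remainder ZERO is PART 17c's `maxwell_form_eq_curl_form` — together with (5.8)–(5.10)
(an2's `indexSymmetric_maxwellKernelZ`, `wardTransversal_maxwellKernelZ`, `momentSummable_maxwellKernelZ` BY NAME, scaled) and
(1.21) (PART 17c `permCovariant_maxwellKernelZ`).  `secondMoment_halfMaxwell_eq_one`: PART 17b's theorem APPLIED to this Setting
gives `1 = secondMoment (½Π^ℤ) μ ν` for every `μ ≠ ν` — and `secondMoment_halfMaxwell_eq_one'` recovers the same number from an2's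
`secondMoment_maxwellKernelZ = 2` (uniqueness of limits through the torus dictionary): the two roads AGREE, an end-to-end check of
the normalisation PART 17b pins.  Nothing of Bałaban's Π^{(j)} is asserted; NOT BetaPertH, NOT continuum, NOT Clay.
-/

namespace Summit.QuantumFields.BalabanUV.Beta.EriceZetaIdentificationWitnessEnd

open Filter Finset
open scoped Topology BigOperators
open Literature.MathematicalPhysics.QuantumFieldTheory.Balaban1983to89
open Literature.MathematicalPhysics.QuantumFieldTheory.Balaban1983to89.Beta
open Literature.MathematicalPhysics.QuantumFieldTheory.Balaban1983to89.Beta.PolarizationSign (size MomentSummable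
  WardTransversal IndexSymmetric)
open Literature.MathematicalPhysics.QuantumFieldTheory.Balaban1983to89.Beta.PolarizationWitnessZd
open Literature.MathematicalPhysics.QuantumFieldTheory.Balaban1983to89.B6BondElimination (unitVec unitVec_apply)
open Literature.MathematicalPhysics.QuantumFieldTheory.BalabanJaffe1986
open Literature.MathematicalPhysics.QuantumFieldTheory.BalabanJaffe1986.BetaFlowAsPrinted
open Summit.QuantumFields.BalabanUV.Beta.EriceZetaIdentificationWitness
open Summit.QuantumFields.BalabanUV.Beta.EriceZetaIdentificationEnd

/-! ## §1. The halved Maxwell kernel keeps (5.8)–(5.10) and (1.21) -/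

/-- Summable third moments of `½Π^ℤ`. [folklore] -/
theorem momentSummable_halfMaxwell : MomentSummable (fun μ ν z => 1 / 2 * maxwellKernelZ 4 μ ν z) 3 := fun μ ν => by
  have h := (momentSummable_maxwellKernelZ (d := 4) 3 μ ν).mul_left (1 / 2)
  refine h.congr fun z => ?_
  rw [abs_mul, abs_of_pos (by norm_num : (0 : ℝ) < 1 / 2)]; ring

/-- Ward transversality of `½Π^ℤ`. [folklore] -/
theorem wardTransversal_halfMaxwell : WardTransversal (fun μ ν z => 1 / 2 * maxwellKernelZ 4 μ ν z) := fun ν z => by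
  have h := wardTransversal_maxwellKernelZ (d := 4) ν z
  have e : ∑ μ, (1 / 2 * maxwellKernelZ 4 μ ν (z - unitVec μ) - 1 / 2 * maxwellKernelZ 4 μ ν z)
      = 1 / 2 * ∑ μ, (maxwellKernelZ 4 μ ν (z - unitVec μ) - maxwellKernelZ 4 μ ν z) := by
    rw [Finset.mul_sum]; exact Finset.sum_congr rfl fun μ _ => by ring
  show ∑ μ, (1 / 2 * maxwellKernelZ 4 μ ν (z - unitVec μ) - 1 / 2 * maxwellKernelZ 4 μ ν z) = 0
  rw [e, h, mul_zero]

/-- Index symmetry of `½Π^ℤ`. [folklore] -/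
theorem indexSymmetric_halfMaxwell : IndexSymmetric (fun μ ν z => 1 / 2 * maxwellKernelZ 4 μ ν z) := fun μ ν x => by
  simp only [indexSymmetric_maxwellKernelZ (d := 4) μ ν x]

/-- Axis-permutation covariance of `½Π^ℤ`. [folklore] -/
theorem permCovariant_halfMaxwell : B12Beta.PermCovariant (fun μ ν z => 1 / 2 * maxwellKernelZ 4 μ ν z) :=
  permCovariant_smul permCovariant_maxwellKernelZ _

/-! ## §2. The witness -/

/-- **NON-VACUITY OF PART 17b**: a `Setting` with a NON-ZERO vacuum polarization (½Π^ℤ, an2's Maxwell kernel halved) satisfying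
`Definitions` and every hypothesis of `EriceZetaIdentificationEnd.zeta_eq_secondMoment_of_365_367` — (N-adm) with c = 1,
(N-curl), `MomentSummable · 3`, `WardTransversal`, `IndexSymmetric`, `PermCovariant` — with ζ ≡ 1; the identification theorem
then yields `1 = secondMoment (½Π^ℤ) μ ν` for every `μ ≠ ν`. [folklore] -/
theorem hypotheses_inhabited :
    ∃ S : Setting, Definitions S ∧
      (∀ j, 1 ≤ j → ∃ c : ℝ, 0 < c ∧ ∀ B : Fld, (∀ a, |B a| ≤ c) → B ∈ S.adm j) ∧
      (∀ j, 1 ≤ j → ∀ B ∈ S.adm j, S.halfCurlSq B = (1 / 4) * ∑' x : Fin 4 → ℤ, ∑ μ, ∑ ν,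
        (B (x, μ) + B (x + unitVec μ, ν) - B (x + unitVec ν, μ) - B (x, ν)) ^ 2) ∧
      (∀ j s, MomentSummable (S.vacPol j s) 3 ∧ WardTransversal (S.vacPol j s) ∧ IndexSymmetric (S.vacPol j s) ∧
        B12Beta.PermCovariant (S.vacPol j s)) ∧
      (∀ j s, S.vacPol j s = fun μ ν z => 1 / 2 * maxwellKernelZ 4 μ ν z) ∧ (∀ j s, S.ζ j s = 1) ∧ S.s0 = 1 ∧
      (∀ μ ν : Fin 4, μ ≠ ν → (1 : ℝ) = B12Beta.secondMoment (fun μ ν z => 1 / 2 * maxwellKernelZ 4 μ ν z) μ ν) := by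
  classical
  let S : Setting :=
    { L := 2
      Cfg := Unit
      Dom := Unit
      E := ⟨fun _ => ∅, fun _ => 0, fun _ _ _ => 0⟩
      C333 := 0
      κ := 0
      h1bAnalyticExtension := True
      a := 1
      p := 5
      s0 := 1
      h3Regularity347 := True
      h5GaugeInvariantDifferentiable := True
      h6Semisimple := True
      βΛ := fun _ _ => 1
      βE := fun _ _ => 1
      adm := fun _ => Set.univ
      quad := fun _ _ B => (1 / 2 : ℝ) * B.sum (fun a ba => B.sum (fun b bb => ba * (1 / 2 * maxwellKernelZ 4 a.2 b.2 (a.1 - b.1)) * bb))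
      halfCurlSq := fun B => (1 / 4) * ∑' x : Fin 4 → ℤ, ∑ μ, ∑ ν,
        (B (x, μ) + B (x + unitVec μ, ν) - B (x + unitVec ν, μ) - B (x, ν)) ^ 2
      sites := fun _ => 1
      r := fun _ => 1
      ζ := fun _ _ => 1
      α := 1
      C365 := 0
      vacPol := fun _ _ μ ν z => 1 / 2 * maxwellKernelZ 4 μ ν z }
  -- the one non-trivial field equation: (3.67)'s double sum = the curl form (PART 17c)
  have hquad : ∀ B : Fld, S.quad 1 0 B = S.halfCurlSq B := by
    intro B
    show (1 / 2 : ℝ) * B.sum (fun a ba => B.sum (fun b bb => ba * (1 / 2 * maxwellKernelZ 4 a.2 b.2 (a.1 - b.1)) * bb))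
      = (1 / 4) * ∑' x : Fin 4 → ℤ, ∑ μ, ∑ ν, (B (x, μ) + B (x + unitVec μ, ν) - B (x + unitVec ν, μ) - B (x, ν)) ^ 2
    set W : Finset (Fin 4 → ℤ) := B.support.image Prod.fst with hW
    have hBW : ∀ x ∉ W, ∀ μ, B (x, μ) = 0 := fun x hx μ => by
      by_contra h
      exact hx (Finset.mem_image.mpr ⟨(x, μ), Finsupp.mem_support_iff.mpr h, rfl⟩)
    have hsupp : B.support ⊆ W ×ˢ Finset.univ := fun a ha =>
      Finset.mem_product.mpr ⟨Finset.mem_image.mpr ⟨a, ha, rfl⟩, Finset.mem_univ _⟩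
    have hin : ∀ (p : (Fin 4 → ℤ) × Fin 4) (bp : ℝ),
        B.sum (fun q bq => bp * (1 / 2 * maxwellKernelZ 4 p.2 q.2 (p.1 - q.1)) * bq)
          = ∑ q ∈ W ×ˢ Finset.univ, bp * (1 / 2 * maxwellKernelZ 4 p.2 q.2 (p.1 - q.1)) * B q := fun p bp =>
      Finsupp.sum_of_support_subset B hsupp _ (fun q _ => by ring)
    rw [Finsupp.sum_of_support_subset B hsupp _ (fun p _ => by rw [hin]; simp)]
    simp_rw [hin, Finset.sum_product]
    exact maxwell_form_eq_curl_form (d := 4) (fun x μ => B (x, μ)) hBW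
  have hD : Definitions S :=
    { d362 := fun _ _ => rfl
      d365 := ⟨by norm_num [S], fun j _ s _ B _ => by
        have h1 : S.quad j s B = S.quad 1 0 B := rfl
        have h2 : S.ζ j s = 1 := rfl
        rw [h1, hquad B, h2, one_mul, sub_self, abs_zero]
        norm_num [S]⟩
      d366 := fun _ _ => rfl
      d367 := fun _ _ _ _ _ => rfl }
  have hsym : ∀ j s, MomentSummable (S.vacPol j s) 3 ∧ WardTransversal (S.vacPol j s) ∧ IndexSymmetric (S.vacPol j s) ∧
      B12Beta.PermCovariant (S.vacPol j s) := fun _ _ =>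
    ⟨momentSummable_halfMaxwell, wardTransversal_halfMaxwell, indexSymmetric_halfMaxwell, permCovariant_halfMaxwell⟩
  have hadm : ∀ j, 1 ≤ j → ∃ c : ℝ, 0 < c ∧ ∀ B : Fld, (∀ a, |B a| ≤ c) → B ∈ S.adm j :=
    fun _ _ => ⟨1, one_pos, fun _ _ => Set.mem_univ _⟩
  have hcurl : ∀ j, 1 ≤ j → ∀ B ∈ S.adm j, S.halfCurlSq B = (1 / 4) * ∑' x : Fin 4 → ℤ, ∑ μ, ∑ ν,
      (B (x, μ) + B (x + unitVec μ, ν) - B (x + unitVec ν, μ) - B (x, ν)) ^ 2 := fun _ _ _ _ => rfl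
  refine ⟨S, hD, hadm, hcurl, hsym, fun _ _ => rfl, fun _ _ => rfl, rfl, fun μ ν hμν => ?_⟩
  have hs : (0 : ℝ) ∈ Set.Icc 0 S.s0 := ⟨le_rfl, by norm_num [S]⟩
  exact zeta_eq_secondMoment_of_365_367 S hD le_rfl hs (hadm 1 le_rfl) (hcurl 1 le_rfl) momentSummable_halfMaxwell
    wardTransversal_halfMaxwell indexSymmetric_halfMaxwell permCovariant_halfMaxwell hμν

/-- **The two roads agree**: an2's `secondMoment_maxwellKernelZ = 2` (finite-volume evaluation + the torus dictionary) halved is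
the number PART 17b's identification produced above: `secondMoment (½Π^ℤ) μ ν = 1`, `μ ≠ ν`. [folklore] -/
theorem secondMoment_halfMaxwell_eq_one {μ ν : Fin 4} (hμν : μ ≠ ν) :
    B12Beta.secondMoment (fun μ ν z => 1 / 2 * maxwellKernelZ 4 μ ν z) μ ν = 1 := by
  unfold B12Beta.secondMoment
  have h := secondMoment_maxwellKernelZ (d := 4) hμν
  unfold B12Beta.secondMoment at h
  have e : ∀ x : Fin 4 → ℤ, 1 / 2 * maxwellKernelZ 4 μ ν x * (x μ : ℝ) * (x ν : ℝ)
      = 1 / 2 * (maxwellKernelZ 4 μ ν x * (x μ : ℝ) * (x ν : ℝ)) := fun x => by ring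
  simp_rw [e]
  rw [tsum_mul_left, h]; norm_num

end Summit.QuantumFields.BalabanUV.Beta.EriceZetaIdentificationWitnessEnd
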